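import Summits.CriticalPhenomena.PercolationContinuityZ3.Theorems.PercNearOneGluingNoHeavyLowerTailAntipodalR1TwoCutGrades
import HarnessLib

/-!
# ANTI₁ across a 2-separation, VIII: the GRADED reduction theorem

Support file for `stmt-CriticalPhenomena-4575` (memo `prim-gen-kcluster/KCLUSTER-gen76.md` §2, graded
form; conjecture ANTI₁-GRADED of `KCLUSTER-gen52.md` §3 — the form that implies the refined row R1 for the
random-cluster measures with `q ≥ 1`, gen-52 LEMMA F).  No definitions, no named facts, no sorries.
Vocabulary of `AntipodalR1` (gen 62); grades as in `…AntipodalR1NestedGraded` / part VII: the GRADE of a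
colouring `x` of `ends : ι → Sym2 V` (vertex type `V` finite) is
`g(x) = #CC(fromEdgeSet {s | ∃ e, x e = true ∧ ends e = s}) + #CC(fromEdgeSet {s | ∃ e, x e = false ∧ ends e = s})`,
and ANTI₁-GRADED says `#{x ∈ L : g(x) = t} ≤ #{x ∈ R(b,c) : g(x) = t}` for every level `t` (written
below with `univ.filter fun x => x ∈ L ∧ g(x) = t`).

**Theorem** (`card_lSet_grade_le_of_twoCut`, the graded 2-CUT REDUCTION).  In the setting of part III
(`G = G₁ ∪ G₂` glued along `{u, v}`: `Sum.elim ends₁ ends₂`, every vertex met by an edge of `G₁`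
non-interior for `G₂`, `a, b, c` non-interior): if ANTI₁-GRADED holds for `G₁`, for `G₁ + uv`, and (fibre
form, colourings `ω₁ ⊕ id`) for `G₁ + e_O + e_K`, then ANTI₁-GRADED holds for `G`.  No hypothesis on `G₂`.

Proof: as in part III, fibrewise over the colouring `ω₂` of `G₂`, pairing `ω₂` with `ω̄₂`; the grade
shift of part VII (`g_G(ω₁ ⊕ ω₂) + 2·#I = g_{G'}(ω₁ ⊕ gadget) + c(ω₂)`, `c(ω̄₂) = c(ω₂)`) makes every
fibrewise embedding land in a single level of the reduced system (`fibre_pair_grade_le`).  [this work]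
-/

namespace Summit.CriticalPhenomena.PercolationContinuityZ3.Theorems

namespace AntipodalR1

open Finset Relation SimpleGraph

variable {V ι₁ ι₂ : Type*}

section Count

variable {ends₁ : ι₁ → Sym2 V} {ends₂ : ι₂ → Sym2 V} {u v a b c : V}
variable [Fintype V] [Fintype ι₁] [DecidableEq ι₁] [Fintype ι₂] [DecidableEq ι₂]

/-- Fibres of a level set of `G₁ + e` over the colour of `e`. [this work] -/
theorem card_level_plusEdge_eq (S : (ι₁ ⊕ Unit → Bool) → Prop) [DecidablePred S] :
    (univ.filter fun x : ι₁ ⊕ Unit → Bool => S x).card =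
      (univ.filter fun ω₁ : ι₁ → Bool => S (Sum.elim ω₁ (fun _ : Unit => true))).card +
        (univ.filter fun ω₁ : ι₁ → Bool => S (Sum.elim ω₁ (fun _ : Unit => false))).card := by
  classical
  rw [card_eq_card_fibre_true_add_false (univ.filter fun x : ι₁ ⊕ Unit → Bool => S x)]
  congr 1
  · exact congrArg Finset.card (filter_congr fun ω₁ _ => by simp)
  · exact congrArg Finset.card (filter_congr fun ω₁ _ => by simp)

open Classical in
/-- **The paired graded fibre inequality.**  Under the three graded hypotheses, for every colouring `ω₂`
of `G₂` and every level `t`: `#L_t-fibre(ω₂) + #L_t-fibre(ω̄₂) ≤ #R_t-fibre(ω₂) + #R_t-fibre(ω̄₂)`.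
[this work] -/
theorem fibre_pair_grade_le
    (hsep : ∀ w i, w ∈ ends₁ i → ∀ j, w ∈ ends₂ j → w = u ∨ w = v)
    (ha : ∀ j, a ∈ ends₂ j → a = u ∨ a = v) (hb : ∀ j, b ∈ ends₂ j → b = u ∨ b = v)
    (hc : ∀ j, c ∈ ends₂ j → c = u ∨ c = v)
    (h0 : ∀ t, (univ.filter fun ω₁ : ι₁ → Bool => ω₁ ∈ lSet ends₁ a b c ∧
        (Nat.card (fromEdgeSet {s : Sym2 V | ∃ e, ω₁ e = true ∧ ends₁ e = s}).ConnectedComponent +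
        Nat.card (fromEdgeSet {s : Sym2 V | ∃ e, ω₁ e = false ∧ ends₁ e = s}).ConnectedComponent) = t).card ≤
      (univ.filter fun ω₁ : ι₁ → Bool => ω₁ ∈ rSet ends₁ a b c ∧
        (Nat.card (fromEdgeSet {s : Sym2 V | ∃ e, ω₁ e = true ∧ ends₁ e = s}).ConnectedComponent +
        Nat.card (fromEdgeSet {s : Sym2 V | ∃ e, ω₁ e = false ∧ ends₁ e = s}).ConnectedComponent) = t).card)
    (h1 : ∀ t, (univ.filter fun x : ι₁ ⊕ Unit → Bool =>
        x ∈ lSet (Sum.elim ends₁ (fun _ : Unit => s(u, v))) a b c ∧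
        (Nat.card (fromEdgeSet {s : Sym2 V | ∃ e, x e = true ∧
          Sum.elim ends₁ (fun _ : Unit => s(u, v)) e = s}).ConnectedComponent +
        Nat.card (fromEdgeSet {s : Sym2 V | ∃ e, x e = false ∧
          Sum.elim ends₁ (fun _ : Unit => s(u, v)) e = s}).ConnectedComponent) = t).card ≤
      (univ.filter fun x : ι₁ ⊕ Unit → Bool =>
        x ∈ rSet (Sum.elim ends₁ (fun _ : Unit => s(u, v))) a b c ∧
        (Nat.card (fromEdgeSet {s : Sym2 V | ∃ e, x e = true ∧
          Sum.elim ends₁ (fun _ : Unit => s(u, v)) e = s}).ConnectedComponent +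
        Nat.card (fromEdgeSet {s : Sym2 V | ∃ e, x e = false ∧
          Sum.elim ends₁ (fun _ : Unit => s(u, v)) e = s}).ConnectedComponent) = t).card)
    (h2 : ∀ t, (univ.filter fun ω₁ : ι₁ → Bool =>
        Sum.elim ω₁ id ∈ lSet (Sum.elim ends₁ (fun _ : Bool => s(u, v))) a b c ∧
        (Nat.card (fromEdgeSet {s : Sym2 V | ∃ e, Sum.elim ω₁ id e = true ∧
          Sum.elim ends₁ (fun _ : Bool => s(u, v)) e = s}).ConnectedComponent +
        Nat.card (fromEdgeSet {s : Sym2 V | ∃ e, Sum.elim ω₁ id e = false ∧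
          Sum.elim ends₁ (fun _ : Bool => s(u, v)) e = s}).ConnectedComponent) = t).card ≤
      (univ.filter fun ω₁ : ι₁ → Bool =>
        Sum.elim ω₁ id ∈ rSet (Sum.elim ends₁ (fun _ : Bool => s(u, v))) a b c ∧
        (Nat.card (fromEdgeSet {s : Sym2 V | ∃ e, Sum.elim ω₁ id e = true ∧
          Sum.elim ends₁ (fun _ : Bool => s(u, v)) e = s}).ConnectedComponent +
        Nat.card (fromEdgeSet {s : Sym2 V | ∃ e, Sum.elim ω₁ id e = false ∧
          Sum.elim ends₁ (fun _ : Bool => s(u, v)) e = s}).ConnectedComponent) = t).card)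
    (ω₂ : ι₂ → Bool) (t : ℕ) :
    (univ.filter fun ω₁ : ι₁ → Bool => Sum.elim ω₁ ω₂ ∈ lSet (Sum.elim ends₁ ends₂) a b c ∧
        (Nat.card (fromEdgeSet {s : Sym2 V | ∃ e, Sum.elim ω₁ ω₂ e = true ∧
          Sum.elim ends₁ ends₂ e = s}).ConnectedComponent +
        Nat.card (fromEdgeSet {s : Sym2 V | ∃ e, Sum.elim ω₁ ω₂ e = false ∧
          Sum.elim ends₁ ends₂ e = s}).ConnectedComponent) = t).card +
      (univ.filter fun ω₁ : ι₁ → Bool => Sum.elim ω₁ (fun j => !ω₂ j) ∈ lSet (Sum.elim ends₁ ends₂) a b c ∧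
        (Nat.card (fromEdgeSet {s : Sym2 V | ∃ e, Sum.elim ω₁ (fun j => !ω₂ j) e = true ∧
          Sum.elim ends₁ ends₂ e = s}).ConnectedComponent +
        Nat.card (fromEdgeSet {s : Sym2 V | ∃ e, Sum.elim ω₁ (fun j => !ω₂ j) e = false ∧
          Sum.elim ends₁ ends₂ e = s}).ConnectedComponent) = t).card ≤
    (univ.filter fun ω₁ : ι₁ → Bool => Sum.elim ω₁ ω₂ ∈ rSet (Sum.elim ends₁ ends₂) a b c ∧
        (Nat.card (fromEdgeSet {s : Sym2 V | ∃ e, Sum.elim ω₁ ω₂ e = true ∧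
          Sum.elim ends₁ ends₂ e = s}).ConnectedComponent +
        Nat.card (fromEdgeSet {s : Sym2 V | ∃ e, Sum.elim ω₁ ω₂ e = false ∧
          Sum.elim ends₁ ends₂ e = s}).ConnectedComponent) = t).card +
      (univ.filter fun ω₁ : ι₁ → Bool => Sum.elim ω₁ (fun j => !ω₂ j) ∈ rSet (Sum.elim ends₁ ends₂) a b c ∧
        (Nat.card (fromEdgeSet {s : Sym2 V | ∃ e, Sum.elim ω₁ (fun j => !ω₂ j) e = true ∧
          Sum.elim ends₁ ends₂ e = s}).ConnectedComponent +
        Nat.card (fromEdgeSet {s : Sym2 V | ∃ e, Sum.elim ω₁ (fun j => !ω₂ j) e = false ∧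
          Sum.elim ends₁ ends₂ e = s}).ConnectedComponent) = t).card := by
  have hcflip :
      (Nat.card {D : (fromEdgeSet {s : Sym2 V | ∃ j, (!ω₂ j) = true ∧ ends₂ j = s}).ConnectedComponent //
            ¬ ∃ x, x ∉ {w : V | ¬ ∀ j, w ∈ ends₂ j → w = u ∨ w = v} ∧
              (fromEdgeSet {s : Sym2 V | ∃ j, (!ω₂ j) = true ∧ ends₂ j = s}).connectedComponentMk x = D} +
          Nat.card {D : (fromEdgeSet {s : Sym2 V | ∃ j, (!ω₂ j) = false ∧ ends₂ j = s}).ConnectedComponent //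
            ¬ ∃ x, x ∉ {w : V | ¬ ∀ j, w ∈ ends₂ j → w = u ∨ w = v} ∧
              (fromEdgeSet {s : Sym2 V | ∃ j, (!ω₂ j) = false ∧ ends₂ j = s}).connectedComponentMk x = D}) =
      (Nat.card {D : (fromEdgeSet {s : Sym2 V | ∃ j, ω₂ j = true ∧ ends₂ j = s}).ConnectedComponent //
            ¬ ∃ x, x ∉ {w : V | ¬ ∀ j, w ∈ ends₂ j → w = u ∨ w = v} ∧
              (fromEdgeSet {s : Sym2 V | ∃ j, ω₂ j = true ∧ ends₂ j = s}).connectedComponentMk x = D} +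
          Nat.card {D : (fromEdgeSet {s : Sym2 V | ∃ j, ω₂ j = false ∧ ends₂ j = s}).ConnectedComponent //
            ¬ ∃ x, x ∉ {w : V | ¬ ∀ j, w ∈ ends₂ j → w = u ∨ w = v} ∧
              (fromEdgeSet {s : Sym2 V | ∃ j, ω₂ j = false ∧ ends₂ j = s}).connectedComponentMk x = D}) :=
    card_ccInside_flip_add (V := V) (u := u) (v := v) (ends₂ := ends₂) ω₂
  have hflip : ∀ col, v ∈ clus ends₂ (fun j => !ω₂ j) col u ↔ v ∈ clus ends₂ ω₂ (!col) u :=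
    fun col => mem_clus_flip ends₂ ω₂ col u v
  by_cases hO : v ∈ clus ends₂ ω₂ true u <;> by_cases hK : v ∈ clus ends₂ ω₂ false u
  · -- state (joined, joined): both fibres through the two-edge gadget
    have hst : ∀ col, v ∈ clus ends₂ ω₂ col u ↔ (u = v ∨ ∃ k : Bool, id k = col) :=
      fun col => ⟨fun _ => Or.inr ⟨col, rfl⟩, fun _ => by cases col <;> assumption⟩
    have hst' : ∀ col, v ∈ clus ends₂ (fun j => !ω₂ j) col u ↔ (u = v ∨ ∃ k : Bool, id k = col) :=
      fun col => (hflip col).trans ⟨fun _ => Or.inr ⟨col, rfl⟩, fun _ => by cases col <;> assumption⟩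
    refine Nat.add_le_add ?_ ?_
    · refine (card_fibre_lSet_grade_le_gadget hsep ha hb hc ω₂ id hst t).trans
        (le_trans ?_ (card_gadget_rSet_grade_le_fibre hsep ha hb hc ω₂ id hst t))
      exact card_filter_add_le _ _ _ _ h2 _ _
    · refine (card_fibre_lSet_grade_le_gadget hsep ha hb hc _ id hst' t).trans
        (le_trans ?_ (card_gadget_rSet_grade_le_fibre hsep ha hb hc _ id hst' t))
      exact card_filter_add_le _ _ _ _ h2 _ _
  · -- state (open-joined only)
    have huv : u ≠ v := fun h => hK (h ▸ ReflTransGen.refl)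
    have hst : ∀ col, v ∈ clus ends₂ ω₂ col u ↔ (u = v ∨ ∃ _ : Unit, true = col) := by
      intro col; cases col
      · exact ⟨fun h => (hK h).elim, fun h => h.elim (fun h => (huv h).elim) fun ⟨_, h⟩ => by simp at h⟩
      · exact ⟨fun _ => Or.inr ⟨(), rfl⟩, fun _ => hO⟩
    have hst' : ∀ col, v ∈ clus ends₂ (fun j => !ω₂ j) col u ↔ (u = v ∨ ∃ _ : Unit, false = col) := by
      intro col; rw [hflip col]; cases col
      · exact ⟨fun _ => Or.inr ⟨(), rfl⟩, fun _ => hO⟩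
      · exact ⟨fun h => (hK h).elim, fun h => h.elim (fun h => (huv h).elim) fun ⟨_, h⟩ => by simp at h⟩
    have hL1 := card_fibre_lSet_grade_le_gadget hsep ha hb hc ω₂ (fun _ : Unit => true) hst t
    have hL2 := card_fibre_lSet_grade_le_gadget hsep ha hb hc _ (fun _ : Unit => false) hst' t
    have hR1 := card_gadget_rSet_grade_le_fibre hsep ha hb hc ω₂ (fun _ : Unit => true) hst t
    have hR2 := card_gadget_rSet_grade_le_fibre hsep ha hb hc _ (fun _ : Unit => false) hst' t
    rw [hcflip] at hL2 hR2
    have hsum := card_filter_add_le _ _ _ _ h1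
      (Nat.card {D : (fromEdgeSet {s : Sym2 V | ∃ j, ω₂ j = true ∧ ends₂ j = s}).ConnectedComponent //
            ¬ ∃ x, x ∉ {w : V | ¬ ∀ j, w ∈ ends₂ j → w = u ∨ w = v} ∧
              (fromEdgeSet {s : Sym2 V | ∃ j, ω₂ j = true ∧ ends₂ j = s}).connectedComponentMk x = D} +
          Nat.card {D : (fromEdgeSet {s : Sym2 V | ∃ j, ω₂ j = false ∧ ends₂ j = s}).ConnectedComponent //
            ¬ ∃ x, x ∉ {w : V | ¬ ∀ j, w ∈ ends₂ j → w = u ∨ w = v} ∧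
              (fromEdgeSet {s : Sym2 V | ∃ j, ω₂ j = false ∧ ends₂ j = s}).connectedComponentMk x = D})
      (t + 2 * Nat.card {w : V | ¬ ∀ j, w ∈ ends₂ j → w = u ∨ w = v})
    rw [card_level_plusEdge_eq, card_level_plusEdge_eq] at hsum
    exact (Nat.add_le_add hL1 hL2).trans (hsum.trans (Nat.add_le_add hR1 hR2))
  · -- state (closed-joined only): mirror image
    have huv : u ≠ v := fun h => hO (h ▸ ReflTransGen.refl)
    have hst : ∀ col, v ∈ clus ends₂ ω₂ col u ↔ (u = v ∨ ∃ _ : Unit, false = col) := by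
      intro col; cases col
      · exact ⟨fun _ => Or.inr ⟨(), rfl⟩, fun _ => hK⟩
      · exact ⟨fun h => (hO h).elim, fun h => h.elim (fun h => (huv h).elim) fun ⟨_, h⟩ => by simp at h⟩
    have hst' : ∀ col, v ∈ clus ends₂ (fun j => !ω₂ j) col u ↔ (u = v ∨ ∃ _ : Unit, true = col) := by
      intro col; rw [hflip col]; cases col
      · exact ⟨fun h => (hO h).elim, fun h => h.elim (fun h => (huv h).elim) fun ⟨_, h⟩ => by simp at h⟩
      · exact ⟨fun _ => Or.inr ⟨(), rfl⟩, fun _ => hK⟩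
    have hL1 := card_fibre_lSet_grade_le_gadget hsep ha hb hc ω₂ (fun _ : Unit => false) hst t
    have hL2 := card_fibre_lSet_grade_le_gadget hsep ha hb hc _ (fun _ : Unit => true) hst' t
    have hR1 := card_gadget_rSet_grade_le_fibre hsep ha hb hc ω₂ (fun _ : Unit => false) hst t
    have hR2 := card_gadget_rSet_grade_le_fibre hsep ha hb hc _ (fun _ : Unit => true) hst' t
    rw [hcflip] at hL2 hR2
    have hsum := card_filter_add_le _ _ _ _ h1
      (Nat.card {D : (fromEdgeSet {s : Sym2 V | ∃ j, ω₂ j = true ∧ ends₂ j = s}).ConnectedComponent //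
            ¬ ∃ x, x ∉ {w : V | ¬ ∀ j, w ∈ ends₂ j → w = u ∨ w = v} ∧
              (fromEdgeSet {s : Sym2 V | ∃ j, ω₂ j = true ∧ ends₂ j = s}).connectedComponentMk x = D} +
          Nat.card {D : (fromEdgeSet {s : Sym2 V | ∃ j, ω₂ j = false ∧ ends₂ j = s}).ConnectedComponent //
            ¬ ∃ x, x ∉ {w : V | ¬ ∀ j, w ∈ ends₂ j → w = u ∨ w = v} ∧
              (fromEdgeSet {s : Sym2 V | ∃ j, ω₂ j = false ∧ ends₂ j = s}).connectedComponentMk x = D})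
      (t + 2 * Nat.card {w : V | ¬ ∀ j, w ∈ ends₂ j → w = u ∨ w = v})
    rw [card_level_plusEdge_eq, card_level_plusEdge_eq] at hsum
    have hL := Nat.add_le_add hL2 hL1
    have hR := Nat.add_le_add hR2 hR1
    rw [Nat.add_comm] at hL
    exact hL.trans (hsum.trans (hR.trans_eq (Nat.add_comm _ _)))
  · -- state (neither): both fibres through the bare side
    have hO' : v ∉ clus ends₂ (fun j => !ω₂ j) true u := fun h => hK ((hflip true).1 h)
    have hK' : v ∉ clus ends₂ (fun j => !ω₂ j) false u := fun h => hO ((hflip false).1 h)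
    refine Nat.add_le_add ?_ ?_
    · refine (card_fibre_lSet_grade_le_inl hsep ha hb hc ω₂ hO hK t).trans
        (le_trans ?_ (card_rSet_inl_grade_le_fibre hsep ha hb hc ω₂ hO hK t))
      exact card_filter_add_le _ _ _ _ h0 _ _
    · refine (card_fibre_lSet_grade_le_inl hsep ha hb hc _ hO' hK' t).trans
        (le_trans ?_ (card_rSet_inl_grade_le_fibre hsep ha hb hc _ hO' hK' t))
      exact card_filter_add_le _ _ _ _ h0 _ _

open Classical in
/-- **The graded 2-cut reduction for ANTI₁** (memo `KCLUSTER-gen76` §2, graded kernel form).  Let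
`G = G₁ ∪ G₂` be glued along `{u, v}` as in `card_lSet_le_card_rSet_of_twoCut` (part III).  If the
level-by-level inequality ANTI₁-GRADED holds (0) for `G₁`, (1) for `G₁ + uv`, and (2) for the colourings
`ω₁ ⊕ id` of `G₁ + e_O + e_K` (= the contraction `G₁ / uv` up to the constant grade shift `2·[u ≠ v]`),
then ANTI₁-GRADED holds for `G`, at every level `t`.  No hypothesis on `G₂`. [this work] -/
theorem card_lSet_grade_le_of_twoCut (ends₁ : ι₁ → Sym2 V) (ends₂ : ι₂ → Sym2 V)
    (u v a b c : V)
    (hsep : ∀ w i, w ∈ ends₁ i → ∀ j, w ∈ ends₂ j → w = u ∨ w = v)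
    (ha : ∀ j, a ∈ ends₂ j → a = u ∨ a = v) (hb : ∀ j, b ∈ ends₂ j → b = u ∨ b = v)
    (hc : ∀ j, c ∈ ends₂ j → c = u ∨ c = v)
    (h0 : ∀ t, (univ.filter fun ω₁ : ι₁ → Bool => ω₁ ∈ lSet ends₁ a b c ∧
        (Nat.card (fromEdgeSet {s : Sym2 V | ∃ e, ω₁ e = true ∧ ends₁ e = s}).ConnectedComponent +
        Nat.card (fromEdgeSet {s : Sym2 V | ∃ e, ω₁ e = false ∧ ends₁ e = s}).ConnectedComponent) = t).card ≤
      (univ.filter fun ω₁ : ι₁ → Bool => ω₁ ∈ rSet ends₁ a b c ∧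
        (Nat.card (fromEdgeSet {s : Sym2 V | ∃ e, ω₁ e = true ∧ ends₁ e = s}).ConnectedComponent +
        Nat.card (fromEdgeSet {s : Sym2 V | ∃ e, ω₁ e = false ∧ ends₁ e = s}).ConnectedComponent) = t).card)
    (h1 : ∀ t, (univ.filter fun x : ι₁ ⊕ Unit → Bool =>
        x ∈ lSet (Sum.elim ends₁ (fun _ : Unit => s(u, v))) a b c ∧
        (Nat.card (fromEdgeSet {s : Sym2 V | ∃ e, x e = true ∧
          Sum.elim ends₁ (fun _ : Unit => s(u, v)) e = s}).ConnectedComponent +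
        Nat.card (fromEdgeSet {s : Sym2 V | ∃ e, x e = false ∧
          Sum.elim ends₁ (fun _ : Unit => s(u, v)) e = s}).ConnectedComponent) = t).card ≤
      (univ.filter fun x : ι₁ ⊕ Unit → Bool =>
        x ∈ rSet (Sum.elim ends₁ (fun _ : Unit => s(u, v))) a b c ∧
        (Nat.card (fromEdgeSet {s : Sym2 V | ∃ e, x e = true ∧
          Sum.elim ends₁ (fun _ : Unit => s(u, v)) e = s}).ConnectedComponent +
        Nat.card (fromEdgeSet {s : Sym2 V | ∃ e, x e = false ∧
          Sum.elim ends₁ (fun _ : Unit => s(u, v)) e = s}).ConnectedComponent) = t).card)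
    (h2 : ∀ t, (univ.filter fun ω₁ : ι₁ → Bool =>
        Sum.elim ω₁ id ∈ lSet (Sum.elim ends₁ (fun _ : Bool => s(u, v))) a b c ∧
        (Nat.card (fromEdgeSet {s : Sym2 V | ∃ e, Sum.elim ω₁ id e = true ∧
          Sum.elim ends₁ (fun _ : Bool => s(u, v)) e = s}).ConnectedComponent +
        Nat.card (fromEdgeSet {s : Sym2 V | ∃ e, Sum.elim ω₁ id e = false ∧
          Sum.elim ends₁ (fun _ : Bool => s(u, v)) e = s}).ConnectedComponent) = t).card ≤
      (univ.filter fun ω₁ : ι₁ → Bool =>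
        Sum.elim ω₁ id ∈ rSet (Sum.elim ends₁ (fun _ : Bool => s(u, v))) a b c ∧
        (Nat.card (fromEdgeSet {s : Sym2 V | ∃ e, Sum.elim ω₁ id e = true ∧
          Sum.elim ends₁ (fun _ : Bool => s(u, v)) e = s}).ConnectedComponent +
        Nat.card (fromEdgeSet {s : Sym2 V | ∃ e, Sum.elim ω₁ id e = false ∧
          Sum.elim ends₁ (fun _ : Bool => s(u, v)) e = s}).ConnectedComponent) = t).card)
    (t : ℕ) :
    (univ.filter fun x : ι₁ ⊕ ι₂ → Bool => x ∈ lSet (Sum.elim ends₁ ends₂) a b c ∧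
        (Nat.card (fromEdgeSet {s : Sym2 V | ∃ e, x e = true ∧
          Sum.elim ends₁ ends₂ e = s}).ConnectedComponent +
        Nat.card (fromEdgeSet {s : Sym2 V | ∃ e, x e = false ∧
          Sum.elim ends₁ ends₂ e = s}).ConnectedComponent) = t).card ≤
      (univ.filter fun x : ι₁ ⊕ ι₂ → Bool => x ∈ rSet (Sum.elim ends₁ ends₂) a b c ∧
        (Nat.card (fromEdgeSet {s : Sym2 V | ∃ e, x e = true ∧
          Sum.elim ends₁ ends₂ e = s}).ConnectedComponent +
        Nat.card (fromEdgeSet {s : Sym2 V | ∃ e, x e = false ∧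
          Sum.elim ends₁ ends₂ e = s}).ConnectedComponent) = t).card := by
  rw [card_eq_sum_card_fibre (univ.filter fun x : ι₁ ⊕ ι₂ → Bool =>
      x ∈ lSet (Sum.elim ends₁ ends₂) a b c ∧
        (Nat.card (fromEdgeSet {s : Sym2 V | ∃ e, x e = true ∧
          Sum.elim ends₁ ends₂ e = s}).ConnectedComponent +
        Nat.card (fromEdgeSet {s : Sym2 V | ∃ e, x e = false ∧
          Sum.elim ends₁ ends₂ e = s}).ConnectedComponent) = t),
    card_eq_sum_card_fibre (univ.filter fun x : ι₁ ⊕ ι₂ → Bool =>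
      x ∈ rSet (Sum.elim ends₁ ends₂) a b c ∧
        (Nat.card (fromEdgeSet {s : Sym2 V | ∃ e, x e = true ∧
          Sum.elim ends₁ ends₂ e = s}).ConnectedComponent +
        Nat.card (fromEdgeSet {s : Sym2 V | ∃ e, x e = false ∧
          Sum.elim ends₁ ends₂ e = s}).ConnectedComponent) = t)]
  have hfibL : ∀ ω₂ : ι₂ → Bool, (univ.filter fun ω₁ : ι₁ → Bool => Sum.elim ω₁ ω₂ ∈
      univ.filter fun x : ι₁ ⊕ ι₂ → Bool => x ∈ lSet (Sum.elim ends₁ ends₂) a b c ∧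
        (Nat.card (fromEdgeSet {s : Sym2 V | ∃ e, x e = true ∧
          Sum.elim ends₁ ends₂ e = s}).ConnectedComponent +
        Nat.card (fromEdgeSet {s : Sym2 V | ∃ e, x e = false ∧
          Sum.elim ends₁ ends₂ e = s}).ConnectedComponent) = t).card =
      (univ.filter fun ω₁ : ι₁ → Bool => Sum.elim ω₁ ω₂ ∈ lSet (Sum.elim ends₁ ends₂) a b c ∧
        (Nat.card (fromEdgeSet {s : Sym2 V | ∃ e, Sum.elim ω₁ ω₂ e = true ∧
          Sum.elim ends₁ ends₂ e = s}).ConnectedComponent +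
        Nat.card (fromEdgeSet {s : Sym2 V | ∃ e, Sum.elim ω₁ ω₂ e = false ∧
          Sum.elim ends₁ ends₂ e = s}).ConnectedComponent) = t).card :=
    fun ω₂ => congrArg Finset.card (filter_congr fun ω₁ _ => by
      simp only [mem_filter, mem_univ, true_and])
  have hfibR : ∀ ω₂ : ι₂ → Bool, (univ.filter fun ω₁ : ι₁ → Bool => Sum.elim ω₁ ω₂ ∈
      univ.filter fun x : ι₁ ⊕ ι₂ → Bool => x ∈ rSet (Sum.elim ends₁ ends₂) a b c ∧
        (Nat.card (fromEdgeSet {s : Sym2 V | ∃ e, x e = true ∧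
          Sum.elim ends₁ ends₂ e = s}).ConnectedComponent +
        Nat.card (fromEdgeSet {s : Sym2 V | ∃ e, x e = false ∧
          Sum.elim ends₁ ends₂ e = s}).ConnectedComponent) = t).card =
      (univ.filter fun ω₁ : ι₁ → Bool => Sum.elim ω₁ ω₂ ∈ rSet (Sum.elim ends₁ ends₂) a b c ∧
        (Nat.card (fromEdgeSet {s : Sym2 V | ∃ e, Sum.elim ω₁ ω₂ e = true ∧
          Sum.elim ends₁ ends₂ e = s}).ConnectedComponent +
        Nat.card (fromEdgeSet {s : Sym2 V | ∃ e, Sum.elim ω₁ ω₂ e = false ∧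
          Sum.elim ends₁ ends₂ e = s}).ConnectedComponent) = t).card :=
    fun ω₂ => congrArg Finset.card (filter_congr fun ω₁ _ => by
      simp only [mem_filter, mem_univ, true_and])
  simp only [hfibL, hfibR]
  exact sum_le_sum_of_pair fun ω₂ => fibre_pair_grade_le hsep ha hb hc h0 h1 h2 ω₂ t

end Count

end AntipodalR1

end Summit.CriticalPhenomena.PercolationContinuityZ3.Theorems
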